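import Literature.Geometry.Lorentzian.KerrRadiationFieldFrame
import HarnessLib

/-!
# The null gap of the leaves `Σ̃_τ(h♯_{R₁})`: `0 ≤ c_null(x) − σ♯(r) ≤ 4M²/Δ + 2Ma²(r + 2M)/(r(r − 2M)Δ)`

(family `gr`; infrastructure for the far-region `r^p`-weighted estimates behind statement **gr.S24**
— the named fact `Kerr.dafermosRodnianski_pHierarchy_scri` of `KerrDecayHierarchy.lean`;
namespace `Literature.Geometry.Lorentzian.Kerr`)

The `V`-energy density through a radial graph with conormal `ν_c = dt* − c dr` degenerates in the
transversal derivative with the coefficient `¼(1 + 2H)(1 − 2H)(c_null(x) − c)`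
(`KerrNullFrameFlux.lean`, `Kerr.vSq_coeff_eq`), where `c_null(x) = (1 + 2H(x))/(1 − 2H(x))` is the
null slope `dt*/dr` of the outgoing vector `m` of the `(∂_{t*}, ℓ♯)`-plane at `x`. For `a ≠ 0` it
depends on the latitude through `H = Mr/Σ`, `Σ = r² + a²z²/r² ∈ [r², r² + a²]`:

* `Kerr.div_le_scalarH` — `Mr/(r² + a²) ≤ H` (poles) and (`Kerr.scalarH_le_div`) `H ≤ M/r` (equator);
* `Kerr.outgoingNullSlope_le_nullSlope` — the minimum over the latitude is the slope
  `2(r² + a²)/Δ − 1 = (r² + 2Mr + a²)/Δ` of the principal null cones of `KerrHyperboloidalFlux.lean`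
  (`Kerr.outgoingNullSlope_sub_scriSlope`): **`2(r² + a²)/Δ − 1 ≤ c_null(x)`** (`Δ = r² − 2Mr + a² > 0`,
  `2H < 1`);
* (`Kerr.nullSlope_le`, `KerrRadiationFieldFrame.lean`) the maximum is `(r + 2M)/(r − 2M)` (`r > 2M`);
* hence for the far slope `σ♯(r) = (r² + a²)/Δ + 2M/r` of the leaves `Σ̃_τ(h♯_{R₁})` (their conormal is
  `radialConormal a x (χ σ♯)`, `Kerr.graphConormal_scriHeight_eq_radialConormal`; `χ = 1` for
  `r ≥ 2R₁`): `Kerr.scriSlope_le_nullSlope` — **`σ♯(r) ≤ c_null(x)`** (the gap is nonnegative at every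
  latitude: the `v²`-coefficient is `≥ 0`, the leaves are sub-null), with the explicit lower gap
  `c_null(x) − σ♯(r) ≥ 2M(2Mr − a²)/(rΔ)`, and `Kerr.nullSlope_sub_scriSlope_le` —
  **`c_null(x) − σ♯(r) ≤ 4M²/Δ + 2Ma²(r + 2M)/(r(r − 2M)Δ)`** — `O(M²/r²)`: on the far parts of the
  leaves the transversal coefficient of the energy density is `O((M² + a²)/r²)`, the weight under
  which the far-region Morawetz estimate controls `(kψ)²`.

All statements are pointwise at points with `r > 2M ≥ 0` (and `Δ(r) > 0` where `Δ` is divided by),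
for `a² ≤ M²` where the factorisation `Δ = (r − r₊)(r − r₋)` is used; no named facts (D-0026).

## References

* M. Dafermos, I. Rodnianski, Y. Shlapentokh-Rothman, arXiv:1402.7034, §2.1.2 (2) (`dr*/dr = (r² + a²)/Δ`),
  §3.3 (key `DafermosRodnianskiShlapentokhrothman2014`).
* G. Moschidis, arXiv:1509.08489 = Ann. PDE 2 (2016), §3.1 (hyperboloids terminating at `𝓘⁺`:
  `du ∼ r^{-1-η′} dv` on them) (key `Moschidis2016`).
-/

noncomputable section

open Set Filter
open scoped Topology

namespace Literature.Geometry.Lorentzian.Kerr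

variable {M a : ℝ} {x : E4}

/-- **`Σ ≤ r² + a²`** (`Σ = r² + a²z²/r²`, `z² ≤ r²`). [cite: arXiv07060622, (33)–(35)] -/
theorem blSigma_spatial_le_sq_add_sq (hx : 0 < radius a x) : blSigma a (E4.spatial x) ≤ radius a x ^ 2 + a ^ 2 := by
  rw [blSigma_spatial_eq_sq_add hx]
  have hz := sq_apply_three_le_sq (a := a) hx
  have h1 : a ^ 2 * x 3 ^ 2 / radius a x ^ 2 ≤ a ^ 2 := by
    rw [div_le_iff₀ (by positivity)]
    exact mul_le_mul_of_nonneg_left hz (sq_nonneg a)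
  linarith

/-- **`Mr/(r² + a²) ≤ H`** for `M ≥ 0` (`H = Mr/Σ`, `Σ ≤ r² + a²`: the minimum of `H` over the
latitude, attained at the poles). [cite: arXiv07060622, (33)] -/
theorem div_le_scalarH (hM : 0 ≤ M) (hx : 0 < radius a x) :
    M * radius a x / (radius a x ^ 2 + a ^ 2) ≤ scalarH M a x := by
  rw [scalarH_eq_div_blSigma M a hx]
  exact div_le_div_of_nonneg_left (by positivity) (blSigma_spatial_pos hx) (blSigma_spatial_le_sq_add_sq hx)

/-- **The principal null slope is the minimal null slope over the latitude**:
`2(r² + a²)/Δ − 1 = (r² + 2Mr + a²)/Δ ≤ (1 + 2H)/(1 − 2H)` at every point with `r = r(x)`,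
`Δ = r² − 2Mr + a² > 0`, `2H < 1`, `M ≥ 0` (`t ↦ (1 + 2t)/(1 − 2t)` is increasing and
`H ≥ Mr/(r² + a²)`, for which the value is `(r² + 2Mr + a²)/Δ`). [cite: DafermosRodnianskiShlapentokhrothman2014, §2.1.2 (2)] -/
theorem outgoingNullSlope_le_nullSlope (hM : 0 ≤ M) (hx : 0 < radius a x)
    (hΔ : 0 < radius a x ^ 2 - 2 * M * radius a x + a ^ 2) (hH : 2 * scalarH M a x < 1) :
    2 * ((radius a x ^ 2 + a ^ 2) / (radius a x ^ 2 - 2 * M * radius a x + a ^ 2)) - 1 ≤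
      (1 + 2 * scalarH M a x) / (1 - 2 * scalarH M a x) := by
  have hHlow := div_le_scalarH hM hx (a := a)
  set r := radius a x
  set H := scalarH M a x
  set D := r ^ 2 - 2 * M * r + a ^ 2
  have hQ : 0 < r ^ 2 + a ^ 2 := by positivity
  -- `H (r² + a²) ≥ M r`
  have hHr : M * r ≤ H * (r ^ 2 + a ^ 2) := by rwa [div_le_iff₀ hQ] at hHlow
  rw [show 2 * ((r ^ 2 + a ^ 2) / D) - 1 = (r ^ 2 + 2 * M * r + a ^ 2) / D from by
    field_simp; ring]
  rw [div_le_div_iff₀ hΔ (by linarith)]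
  -- `(r² + 2Mr + a²)(1 − 2H) ≤ (1 + 2H) D` ⟺ `4 M r ≤ 2H (r² + 2Mr + a² + D) = 4H(r² + a²)`
  nlinarith [hHr]

/-- `2H < 1` for `r > 2M`, `M ≥ 0`. [folklore] -/
theorem two_mul_scalarH_lt_one_of_lt (hM : 0 ≤ M) (hx : 0 < radius a x) (hr2 : 2 * M < radius a x) :
    2 * scalarH M a x < 1 := by
  have hH := scalarH_le_div hM a hx
  have : M / radius a x < 2⁻¹ := by rw [div_lt_iff₀ hx]; linarith
  linarith

/-- **The far slope of the leaves `Σ̃_τ(h♯_{R₁})` is sub-null at every latitude**, quantitatively: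
for `a² ≤ M²`, `M ≥ 0`, at a point with `r = r(x) > 2M` and `Δ(r) = (r − r₊)(r − r₋) > 0`,
`σ♯(r) + 2M(2Mr − a²)/(rΔ) ≤ (1 + 2H(x))/(1 − 2H(x))`
(`σ♯ + 2M(2Mr − a²)/(rΔ) = 2(r² + a²)/Δ − 1`, `Kerr.outgoingNullSlope_sub_scriSlope`, and
`Kerr.outgoingNullSlope_le_nullSlope`). In particular the `v²`-coefficient
`¼(1 + 2H)(1 − 2H)(c_null − σ♯)` of the `V`-energy density through the far parts of the leaves is
nonnegative. [cite: DafermosRodnianskiShlapentokhrothman2014, §3.3] -/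
theorem scriSlope_le_nullSlope (hM : 0 ≤ M) (haM : a ^ 2 ≤ M ^ 2) (hx : 0 < radius a x)
    (hr2 : 2 * M < radius a x) (hΔ : 0 < (radius a x - rPlus M a) * (radius a x - rMinus M a)) :
    scriSlope M a (radius a x) + 2 * M * (2 * M * radius a x - a ^ 2) /
        (radius a x * ((radius a x - rPlus M a) * (radius a x - rMinus M a))) ≤
      (1 + 2 * scalarH M a x) / (1 - 2 * scalarH M a x) := by
  have hfac := sub_rPlus_mul_sub_rMinus haM (radius a x)
  have hgap := outgoingNullSlope_sub_scriSlope (s := radius a x) haM hΔ.ne' hx.ne'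
  have hΔ' : 0 < radius a x ^ 2 - 2 * M * radius a x + a ^ 2 := by rwa [hfac] at hΔ
  have hmin := outgoingNullSlope_le_nullSlope hM hx (a := a) hΔ' (two_mul_scalarH_lt_one_of_lt hM hx hr2)
  rw [hfac] at hgap ⊢
  linarith

/-- **The null gap of the leaves is `O(M²/r²)`**: for `a² ≤ M²`, `M ≥ 0`, at a point with
`r = r(x) > 2M`, `Δ(r) > 0`,
`(1 + 2H)/(1 − 2H) − σ♯(r) ≤ 4M²/Δ + 2Ma²(r + 2M)/(r(r − 2M)Δ)`
(`= (r + 2M)/(r − 2M) − σ♯(r)`, `Kerr.nullSlope_le`; for `a = 0`: `4M²/(r(r − 2M))`). With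
`KerrNullFrameFlux.lean` / `KerrRadiationFieldFrame.lean`: on the far parts `{r ≥ 2R₁}` of the
leaves `Σ̃_τ(h♯_{R₁})` the energy density of `ψ` controls `(kψ)²` only with a weight
`≲ (M² + a²)/r²`. [cite: Moschidis2016, §3.1] -/
theorem nullSlope_sub_scriSlope_le (hM : 0 ≤ M) (haM : a ^ 2 ≤ M ^ 2) (hx : 0 < radius a x)
    (hr2 : 2 * M < radius a x) (hΔ : 0 < (radius a x - rPlus M a) * (radius a x - rMinus M a)) :
    (1 + 2 * scalarH M a x) / (1 - 2 * scalarH M a x) - scriSlope M a (radius a x) ≤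
      4 * M ^ 2 / ((radius a x - rPlus M a) * (radius a x - rMinus M a)) +
        2 * M * a ^ 2 * (radius a x + 2 * M) /
          (radius a x * (radius a x - 2 * M) * ((radius a x - rPlus M a) * (radius a x - rMinus M a))) := by
  have hmax := nullSlope_le hM hx hr2 (a := a)
  have hfac := sub_rPlus_mul_sub_rMinus haM (radius a x)
  rw [hfac] at hΔ ⊢
  set r := radius a x
  set D := r ^ 2 - 2 * M * r + a ^ 2
  have hr0 : r ≠ 0 := hx.ne'
  have hr2' : r - 2 * M ≠ 0 := by linarith
  have key : (r + 2 * M) / (r - 2 * M) - scriSlope M a r =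
      4 * M ^ 2 / D + 2 * M * a ^ 2 * (r + 2 * M) / (r * (r - 2 * M) * D) := by
    rw [scriSlope, hfac]
    field_simp
    ring
  linarith [key]

end Literature.Geometry.Lorentzian.Kerr
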